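import Literature.NumberTheory.Automorphic.UnitaryLatticeTreeEulerRelation   -- ★ elliptic EP relation `#Fix(U⧸K₀) + #Fix(U⧸K₁) = #Fix(U⧸(K₀ ⊓ K₁)) + 1`
import Literature.NumberTheory.Automorphic.FixedPointsQuotientFibration      -- ★ `#Fix_γ(G⧸I) = Σ_{x ∈ Fix_γ(G⧸K)} #Fix_{k_x}(K⧸I_K)`
import HarnessLib

/-!
# R90 · S6 «Ch. 14.1–14.5 stable trace formula» — card W8-i′, FILE 1: the fixed SPECIAL vertices of an elliptic element of `U(3)` at an inert place,
# reduced to the residual census at its fixed HYPERSPECIAL vertices: `#Fix_γ(U⧸K₁) + #Fix_γ(U⧸K₀) = 1 + Σ_{x ∈ Fix_γ(U⧸K₀)} #Fix_{k_x}(K₀ ⧸ I_{K₀})`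
# (`Theorems/R90S6TorusFixedSpecialCount.lean`)

Cell `hodgecm-mathlib`, crux H413 (`stmt-HodgeConjecture-24833`), route of record `HCCMUnconditional`; programme R90-TF, section S6 (base `R90-C14`), seat R90-C14-p05 (g0);
S6 dealer R90-C14-plan (g2) RULING (B) 23:49:48Z «W8-i′ = `#Fix_γ(U ⧸ K₁)` (special vertices) per torus literal at an inert place» (DAG r5 row E1.3.5.2.4 «fixed loci per
torus type», the `(a₀, a₁)` pair consumed by W8-f's displacement-sphere count).  Helper lane `--supports stmt-HodgeConjecture-24833 --as helper`; ONE theorem (no definition,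
no instance, no notation, no named fact, no `sorry`); imports = ★ `Literature.NumberTheory.Automorphic.UnitaryLatticeTreeEulerRelation` + ★
`Literature.NumberTheory.Automorphic.FixedPointsQuotientFibration` + HarnessLib.

THE MATHEMATICS [Kottwitz1988, §2; Serre1980Trees, I §6, II.1.1].  `K` a valued field with an UNRAMIFIED datum `hd : UnramifiedLocalConjDatum σ ϖ`, `U = U(σ, J₀)(K)`
(`J₀ = antidiag(1,1,1)`), `K₀ = U ∩ GL₃(𝒪)` the stabiliser of the self-dual root `L₀`, `K₁ = U ∩ g₁GL₃(𝒪)g₁⁻¹` the stabiliser of the special neighbour `N₁ = g₁·L₀`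
(`g₁ = diag(1,1,ϖ)`), `I = K₀ ⊓ K₁` the Iwahori.  For `γ ∈ U` with finitely many fixed cosets on `U⧸K₀`, `U⧸K₁` and a finite `⟨γ⟩`-orbit of the root (e.g. `γ` regular
elliptic), write `a₀ = #Fix_γ(U⧸K₀)` (fixed HYPERSPECIAL vertices — the unit estate's ★ Flicker values `phiOne ∕ phiTHn ∕ phiTHM`), `a₁ = #Fix_γ(U⧸K₁)` (fixed SPECIAL
vertices — NOT in the tree at an inert place), `e = #Fix_γ(U⧸I)` (fixed edges).  The ★ Euler–Poincaré relation gives `a₀ + a₁ = e + 1`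
(`natCard_fixedBy_add_eq_natCard_fixedBy_inf_add_one_three`), and the ★ fibration `U⧸I → U⧸K₀` counts the fixed edges over the fixed hyperspecial vertices:
`e = Σ_{x ∈ Fix_γ(U⧸K₀)} #Fix_{k_x}(K₀ ⧸ I_{K₀})`, `k_x = r(x)⁻¹ γ r(x) ∈ K₀` the local monodromy for any section `r` (`natCard_fixedBy_quotient_eq_sum_of_le`).  Hence
**`a₁ + a₀ = 1 + Σ_{x ∈ Fix_γ(U⧸K₀)} s(x)`**, `s(x) = #Fix_{k_x}(K₀ ⧸ I_{K₀})` = the number of special neighbours of the fixed hyperspecial vertex `x` fixed by `γ` =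
the number of isotropic points of the residual hermitian plane at `x` fixed by `k̄_x` (★ `UnitaryLatticeTreeFixedStar.mapGL_mul_N₁_eq_iff`), `∈ {0, 1, q+1, q³+1}` by the
residual Jordan type of `k̄_x` — so the only new mathematics left for `a₁` per torus literal is the RESIDUAL CENSUS `x ↦ s(x)` over Flicker's fixed-coset representatives
(sequel files, one per literal × exponent regime).
HONEST LABEL: a composition of two ★ counting lemmas (EP ∘ fibration); count-neutral until the E1.3.5.2.4 residual censuses and W8-f consume it; proves no printed statement.
HC_CM is proved only modulo the 7 printed citations (2 remaining named inputs: hLiu418 = stmt-HodgeConjecture-24832, h413 = stmt-HodgeConjecture-24833) until rung 0 closes.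
-/

set_option autoImplicit false
-- the mandated namespace repeats the single-problem summit's segment (`HodgeConjecture.HodgeConjecture`)
set_option linter.dupNamespace false

noncomputable section

open MulAction
open Literature.NumberTheory.Automorphic Literature.NumberTheory.Automorphic.HermitianLattice Literature.NumberTheory.Automorphic.UnitaryGroup
open Literature.NumberTheory.Automorphic.UnitaryLatticeTree
open scoped Matrix MatrixGroups WithZero Valued

namespace Summit.HodgeConjecture.HodgeConjecture.R90.S6

set_option synthInstance.maxHeartbeats 400000 in
set_option maxHeartbeats 1600000 in
-- the iterated subgroup-quotient carriers `↥K₀ ⧸ I_{K₀}` of the ★ fibration are slow to elaborate at `U(Φ₃)`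
/-- **W8-i′ FILE 1 — THE FIXED SPECIAL VERTICES OF AN ELLIPTIC `γ ∈ U(3)` AT AN INERT PLACE, REDUCED TO THE RESIDUAL CENSUS AT ITS FIXED HYPERSPECIAL VERTICES:
`#Fix_γ(U⧸K₁) + #Fix_γ(U⧸K₀) = 1 + Σ_{x ∈ Fix_γ(U⧸K₀)} #Fix_{k_x}(K₀ ⧸ I_{K₀})`**, `k_x = r(x)⁻¹ γ r(x)` the local monodromy at the fixed hyperspecial vertex `x` for
any section `r` of `U → U⧸K₀`, `I = K₀ ⊓ K₁` the Iwahori (so `K₀ ⧸ I_{K₀}` is the star of the root and `#Fix_{k_x}(K₀ ⧸ I_{K₀})` the number of `γ`-fixed special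
neighbours of `x`).  Hypotheses = those of the ★ EP relation `natCard_fixedBy_add_eq_natCard_fixedBy_inf_add_one_three` (unramified datum, `g₁ = diag(1,1,ϖ)`, finitely
many fixed cosets on `U⧸K₁`, finite `⟨γ⟩`-orbit of the root) with the finiteness on `U⧸K₀` as a `Fintype` and finite fibres, as in the ★ fibration
`natCard_fixedBy_quotient_eq_sum_of_le`; proof = EP ∘ fibration. [cite: Kottwitz1988, §2] [cite: Serre1980Trees, I §6, II.1.1] [cite: BruhatTits1972, §10] -/
theorem natCard_fixedBy_special_add_eq_one_add_sum {K : Type*} [Field K] [Valued K ℤᵐ⁰] [ValuativeRel K] [(Valued.v : Valuation K ℤᵐ⁰).Compatible]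
    {σ : K →+* K} {ϖ : K} (hd : UnramifiedLocalConjDatum σ ϖ)
    (g₁ : GL (Fin 3) K) (hg₁ : (g₁ : Matrix (Fin 3) (Fin 3) K) = Matrix.diagonal ![(1 : K), 1, ϖ])
    (γ : ↥(unitaryGroupOfForm σ ((StdForm.antidiagonal 3).over K)))
    [Fintype (fixedBy (↥(unitaryGroupOfForm σ ((StdForm.antidiagonal 3).over K)) ⧸
      (glInt 3 K).subgroupOf (unitaryGroupOfForm σ ((StdForm.antidiagonal 3).over K))) γ)]
    (hK₁fin : (fixedBy (↥(unitaryGroupOfForm σ ((StdForm.antidiagonal 3).over K)) ⧸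
      ((glInt 3 K).map (MulAut.conj g₁).toMonoidHom).subgroupOf (unitaryGroupOfForm σ ((StdForm.antidiagonal 3).over K))) γ).Finite)
    (horb : (Set.range fun n : ℕ => ((γ ^ n : ↥(unitaryGroupOfForm σ ((StdForm.antidiagonal 3).over K))) :
      ↥(unitaryGroupOfForm σ ((StdForm.antidiagonal 3).over K)) ⧸ (glInt 3 K).subgroupOf (unitaryGroupOfForm σ ((StdForm.antidiagonal 3).over K)))).Finite)
    (r : ↥(unitaryGroupOfForm σ ((StdForm.antidiagonal 3).over K)) ⧸ (glInt 3 K).subgroupOf (unitaryGroupOfForm σ ((StdForm.antidiagonal 3).over K)) →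
      ↥(unitaryGroupOfForm σ ((StdForm.antidiagonal 3).over K)))
    (hr : Function.RightInverse r QuotientGroup.mk)
    [∀ x : fixedBy (↥(unitaryGroupOfForm σ ((StdForm.antidiagonal 3).over K)) ⧸
        (glInt 3 K).subgroupOf (unitaryGroupOfForm σ ((StdForm.antidiagonal 3).over K))) γ,
      Finite (fixedBy (↥((glInt 3 K).subgroupOf (unitaryGroupOfForm σ ((StdForm.antidiagonal 3).over K))) ⧸
        (((glInt 3 K).subgroupOf (unitaryGroupOfForm σ ((StdForm.antidiagonal 3).over K)) ⊓
          ((glInt 3 K).map (MulAut.conj g₁).toMonoidHom).subgroupOf (unitaryGroupOfForm σ ((StdForm.antidiagonal 3).over K))).subgroupOf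
          ((glInt 3 K).subgroupOf (unitaryGroupOfForm σ ((StdForm.antidiagonal 3).over K)))))
        (⟨(r x.1)⁻¹ * γ * r x.1, inv_mul_mul_mem_of_smul_eq r hr γ x.2⟩ :
          ↥((glInt 3 K).subgroupOf (unitaryGroupOfForm σ ((StdForm.antidiagonal 3).over K)))))] :
    Nat.card (fixedBy (↥(unitaryGroupOfForm σ ((StdForm.antidiagonal 3).over K)) ⧸
        ((glInt 3 K).map (MulAut.conj g₁).toMonoidHom).subgroupOf (unitaryGroupOfForm σ ((StdForm.antidiagonal 3).over K))) γ) +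
      Nat.card (fixedBy (↥(unitaryGroupOfForm σ ((StdForm.antidiagonal 3).over K)) ⧸
        (glInt 3 K).subgroupOf (unitaryGroupOfForm σ ((StdForm.antidiagonal 3).over K))) γ) =
      1 + ∑ x : fixedBy (↥(unitaryGroupOfForm σ ((StdForm.antidiagonal 3).over K)) ⧸
          (glInt 3 K).subgroupOf (unitaryGroupOfForm σ ((StdForm.antidiagonal 3).over K))) γ,
        Nat.card (fixedBy (↥((glInt 3 K).subgroupOf (unitaryGroupOfForm σ ((StdForm.antidiagonal 3).over K))) ⧸
          (((glInt 3 K).subgroupOf (unitaryGroupOfForm σ ((StdForm.antidiagonal 3).over K)) ⊓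
            ((glInt 3 K).map (MulAut.conj g₁).toMonoidHom).subgroupOf (unitaryGroupOfForm σ ((StdForm.antidiagonal 3).over K))).subgroupOf
            ((glInt 3 K).subgroupOf (unitaryGroupOfForm σ ((StdForm.antidiagonal 3).over K)))))
          (⟨(r x.1)⁻¹ * γ * r x.1, inv_mul_mul_mem_of_smul_eq r hr γ x.2⟩ :
            ↥((glInt 3 K).subgroupOf (unitaryGroupOfForm σ ((StdForm.antidiagonal 3).over K))))) := by
  classical
  -- EP: `a₀ + a₁ = e + 1`
  have hEP := natCard_fixedBy_add_eq_natCard_fixedBy_inf_add_one_three hd g₁ hg₁ γ (Set.toFinite _) hK₁fin horb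
  -- fibration over `U⧸K₀`: `e = Σ_x #Fix_{k_x}(K₀⧸I_{K₀})`
  have hfib := natCard_fixedBy_quotient_eq_sum_of_le
    (G := ↥(unitaryGroupOfForm σ ((StdForm.antidiagonal 3).over K)))
    (I := (glInt 3 K).subgroupOf (unitaryGroupOfForm σ ((StdForm.antidiagonal 3).over K)) ⊓
      ((glInt 3 K).map (MulAut.conj g₁).toMonoidHom).subgroupOf (unitaryGroupOfForm σ ((StdForm.antidiagonal 3).over K)))
    (K := (glInt 3 K).subgroupOf (unitaryGroupOfForm σ ((StdForm.antidiagonal 3).over K))) inf_le_left r hr γ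
  rw [hfib] at hEP
  omega

end Summit.HodgeConjecture.HodgeConjecture.R90.S6

end
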